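import Summits.Schanuel.Schanuel.Theorems.RootDecomp1KHyper75
import Summits.Schanuel.Schanuel.Theorems.RootDecomp1KHyper51

/-!
# RootDecomp1KHyper — lens 6, generation 18 «BILOG STAIRCASE CELL — THE MEMBER PACKAGE Q1/Q2» (BilogStair.lean EDITION 9 c88597c7…5692, 6929 l; §T appended, §A–§S byte-identical to edition 8 = tree `RootDecomp1KHyper53`–`75`) — continuation (RootDecomp1KHyper76): §T.1 `PiEllMeasure` ⟸ Baker 1975 Thm 3.1 (by name) + §T.2 the good level of the tower

(lens-6 g18 `BilogStair.lean` EDITION 9, sha256 c88597c719d23fd42e88a1c5ede12e838e786bf53aa652e8b381b4b663795692, 6929 l, own farm rc 0 · 0 warn · 0 sorry · axioms std; §A–§S = editions 2–8 (ported as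
`RootDecomp1KHyper53`–`75`), ONE import line (`RootDecomp1KHyper51`, the tree's `HasMeasuredRatAnchor`) ADDED and §T appended in edition 9 (NOTE/CLAIM L1849, critic ACK L1855, NODE/EDITION9 L1872 / REQUEST L1873 / RESULT L1874, writer re-check L1877, critic VERDICT L1879 (CLEARED; the reserved K-R20 THIRD⁗ CELL credit AWARDED to lens-6; port GO));
port by census-1 gen 17 as `RootDecomp1KHyper76`–`79`: 76 = §T.1 `PiEllMeasure`, the Baker 1975 Thm 3.1 copy `Baker1975Thm31` (character-identical to
`Literature.NumberTheory.Transcendental.baker1975_thm_3_1`, consumed BY NAME; TODO: replace by the import + `baker1975_thm_3_1_holds` when the Baker chain builds on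
the farm), `piEllMeasure_of_baker` + §T.2 the good level of the tower; 77 = §T.3 the forms of `z_B`, `SmallFormsArePlantedAt`, LEMMA P `smallFormsArePlanted_zB_of`;
78 = §T.4 the tuple-generic PLANTED-STAIRCASE CRITERION `not_hasHLPairInSpan_of_planted` + `not_hasHLPairInSpan_zB_of` / `not_hasHLPairInSpan_zB_of_baker` (Q1);
79 = §T.5 the `HasMeasuredRatAnchor` placement of `z_B` (Q2: `exists_measured_pair_of_hasMeasuredRatAnchor_zB`, `logLattice_mem_of_hasMeasuredRatAnchor_zB`,
`hasMeasuredRatAnchor_zB_of_mvWeakMeasure`/`'`) + §T.6 `placement_zB''`. PORT EDITS: generic one-liners `mul_le_pow_of_two_le` / `sq_le_two_pow_pred` / `two_pow_le_exp_nat` /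
`half_le_ell` / `tau_lt_one` / `mvaeval_mem_adjoin` private (+ per-part private copies of earlier private helpers); statements and proofs verbatim. `--supports stmt-Schanuel-33363`;
no census credit carried; rung 0 — nothing here proves HyperLiouvilleSchanuel in general.)
-/

open Complex Polynomial IntermediateField Filter
open scoped BigOperators

namespace Summit.Schanuel.Schanuel.Theorems.RootDecomp1KHyper

namespace HyperCell

namespace LatCell

namespace Bilog

variable {n : ℕ}
open Summit.Schanuel.Schanuel.Theorems.RootDecomp1KRelLiouvilleCell (mvPolyMeasure_one_of_polyMeasure ycoeff
  mvaeval_cons_eq_sum mvlen_ycoeff_le natDegree_finSuccEquiv_le_totalDegree norm_mvaeval_le_mvlen_mul_pow)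

open Summit.Schanuel.Schanuel.Theorems.RootDecomp1KGeneric (norm_mvAeval_sub_le norm_cexp_sub_cexp_le lenMv
  lenMv_nonneg)

/-! ## §T  (EDITION 9, generation 18) THE MEMBER PACKAGE: `z_B` has NO hyper-Liouville pair in its span
(`¬ HasHLPairInSpan z_B`, PROVED from a polynomial measure of linear independence of `π, ℓ₀`, itself PROVED from
the tree's record of Baker 1975 Thm 3.1), and the `HasMeasuredRatAnchor` placement of `z_B` (what a measured
rational anchor of `z_B` would assert; the converse construction from a weak measure of `(iπ, iℓ₀)`).

§T.1  `PiEllMeasure` — `|Uπ + Vℓ₀| ≥ (2+|U|+|V|)^{−κ}` (`V ≠ 0`) — from `baker1975_thm_3_1` at `n = 2`,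
      `α = (−1, (3+4i)/5)`, `l = (iπ, iℓ₀)`, `β = (0, U, V)`.
§T.2  arithmetic of the GOOD LEVEL `K` of the tower `a_{k+1} = 2^{(k+1)a_k}`: `a_K < X ≤ a_{K+1}`,
      `(8·2^{a_K}·N)^{κ+2} ≤ 2^{a_{K+1}}`, `X = 2(κ+2)(N+κ+16)`.
§T.3  LEMMA P for `z_B` (`smallFormsArePlanted_zB_of`): mod `PiEllMeasure`, every integer form `h·z_B` with
      `|h·z_B| < exp(−(1+|h|₁)^{m₀})`, `m₀ = 4(κ+2)²(κ+16)`, is `t·h_K` (planted).  At the good level,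
      `2^{a_K}(h·z_B)/i = (Uπ + Vℓ₀) + h₂·2^{a_K}·err_K`; `(U,V) ≠ 0` is impossible (measure vs. tail), and
      `U = V = 0` forces `h = t·h_K` by the parity of `P_K, M_K`.
§T.4  the PLANTED-STAIRCASE CRITERION `not_hasHLPairInSpan_of_planted` (generic `z : Fin 3 → ℂ`; the tree's
      `RootDecomp1KHyper26` reduction made tuple-free) and `not_hasHLPairInSpan_zB_of : PiEllMeasure → ¬ HasHLPairInSpan z_B`,
      `not_hasHLPairInSpan_zB_of_baker : baker1975_thm_3_1 → ¬ HasHLPairInSpan z_B`.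
§T.5  `HasMeasuredRatAnchor z_B`: UNPACKED (`exists_measured_pair_of_hasMeasuredRatAnchor_zB`: an EXPLICIT weakly
      measured — hence algebraically independent — pair `θ ⊂ ℚ(z_B, e^{z_B}, i)` whose field contains two
      ℚ-independent elements of `span_ℤ z_B ⊂ i(ℚπ + ℚℓ₀ + ℚy_B)`), shown to FORCE
      `ℚ(θ) ∩ (i(ℤπ + ℤℓ₀) ∖ 0) ≠ ∅` (`logLattice_mem_of_hasMeasuredRatAnchor_zB` — the measured field meets the
      log lattice `ℤ·log(−1) + ℤ·log α₀`: a measured statement of (π, log α₀)-type), and CONSTRUCTED from a weak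
      measure of `(iπ, iℓ₀)` (`hasMeasuredRatAnchor_zB_of_mvWeakMeasure`) — so `¬ HasMeasuredRatAnchor z_B` would REFUTE
      `MvWeakMeasure (iπ, iℓ₀)` (an algebraic-independence measure for `π` and `log α₀`, conjecturally TRUE and
      neither in the tree nor in Literature): the negative is not a theorem to expect; the placement is recorded
      as «no measured pair available» (NODE-g18 §3).
§T.6  `placement_zB''` — the full K-R20 list for `z_B` mod `PiEllMeasure` / mod `baker1975_thm_3_1`. -/

section MemberPkg

open Summit.Schanuel.Schanuel.Theorems.RootDecomp1KGeneric (HasHLPairInSpan)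

/-! ### §T.1  A polynomial measure of linear independence of `π` and `ℓ₀` -/

/-- **`PiEllMeasure`** — a POLYNOMIAL lower bound for the rank-2 log lattice `ℤπ + ℤℓ₀`: for some `κ`,
`(2 + |U| + |V|)^{−κ} ≤ |U π + V ℓ₀|` for all integers `U` and `V ≠ 0`. -/
def PiEllMeasure : Prop :=
  ∃ κ : ℕ, ∀ U V : ℤ, V ≠ 0 →
    1 / (2 + |(U : ℝ)| + |(V : ℝ)|) ^ κ ≤ |(U : ℝ) * Real.pi + (V : ℝ) * ell|

/-- Witness data «integer polynomial of degree `≤ 2` and height `≤ 6`» for `α₀ = (3+4i)/5`: `5X² − 6X + 5`. -/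
theorem wit_alpha0 :
    ∃ P : ℤ[X], P ≠ 0 ∧ P.natDegree ≤ 2 ∧ (∀ j, |P.coeff j| ≤ ((6 : ℕ) : ℤ)) ∧
      Polynomial.aeval ((3 + 4 * I) / 5) P = 0 := by
  refine ⟨Polynomial.C 5 * X ^ 2 + Polynomial.C (-6) * X + Polynomial.C 5, ?_,
    Polynomial.natDegree_quadratic_le, ?_, ?_⟩
  · intro h
    have := congrArg (Polynomial.eval 0) h
    simp at this
  · intro j
    rw [Polynomial.coeff_add, Polynomial.coeff_add, Polynomial.coeff_C_mul, Polynomial.coeff_C_mul,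
      Polynomial.coeff_X_pow, Polynomial.coeff_X, Polynomial.coeff_C]
    split_ifs <;> first | omega | simp
  · simp only [map_add, map_mul, Polynomial.aeval_C, Polynomial.aeval_X_pow, Polynomial.aeval_X]
    simp only [map_neg, map_ofNat]
    linear_combination (16 / 5 : ℂ) * I_sq

/-- Witness data for `−1`: `X + 1`. -/
theorem wit_neg_one :
    ∃ P : ℤ[X], P ≠ 0 ∧ P.natDegree ≤ 2 ∧ (∀ j, |P.coeff j| ≤ ((6 : ℕ) : ℤ)) ∧
      Polynomial.aeval (-1 : ℂ) P = 0 := by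
  refine ⟨X + 1, X_add_C_ne_zero 1, ?_, ?_, by simp⟩
  · simpa using (natDegree_X_add_C (1 : ℤ)).le.trans (by norm_num : 1 ≤ 2)
  · intro j
    rw [coeff_add, coeff_X, coeff_one]
    split_ifs <;> simp

/-- Witness data for an integer `U` of height `≤ B` (`B ≥ 2`): the polynomial `X − U`. -/
theorem wit_int (U : ℤ) {B : ℕ} (hB : 2 ≤ B) (hU : U.natAbs ≤ B) :
    ∃ Q : ℤ[X], Q ≠ 0 ∧ Q.natDegree ≤ 2 ∧ (∀ k, |Q.coeff k| ≤ (B : ℤ)) ∧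
      Polynomial.aeval (U : ℂ) Q = 0 := by
  refine ⟨X - Polynomial.C U, Polynomial.X_sub_C_ne_zero U, ?_, ?_, by simp⟩
  · rw [Polynomial.natDegree_X_sub_C]; norm_num
  · intro k
    have hUB : |U| ≤ (B : ℤ) := by rw [← Int.natCast_natAbs]; exact_mod_cast hU
    have hB1 : (1 : ℤ) ≤ B := by exact_mod_cast (show 1 ≤ B by omega)
    have hB0 : (0 : ℤ) ≤ B := by positivity
    rw [Polynomial.coeff_sub, Polynomial.coeff_X, Polynomial.coeff_C]
    by_cases hk0 : k = 0
    · subst hk0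
      simpa using hUB
    · by_cases hk1 : k = 1
      · subst hk1
        simpa using hB1
      · simp [hk0, Ne.symm hk1, hB0]

/-- **Baker 1975, Theorem 3.1** — a CHARACTER-IDENTICAL local copy of the tree's Literature record
`Literature.NumberTheory.Transcendental.baker1975_thm_3_1` (file `Literature/NumberTheory/Transcendental/
BakerLinearFormsQuantitative.lean`), which the tree PROVES as `Literature.NumberTheory.Transcendental.baker1975_thm_3_1_holds`
(file `…/BakerLinearFormsQuantitativeProofs.lean`); `Baker1975Thm31 ↔ baker1975_thm_3_1` is `Iff.rfl` in any module importing
both (the HOME kernel keeps its import list minimal; the census port discharges the hypothesis by `baker1975_thm_3_1_holds`).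
For `n, d, A ∈ ℕ`, non-zero `α₁, …, αₙ ∈ ℂ` each a root of a non-zero integer polynomial of degree `≤ d` and height `≤ A`,
and determinations `lᵢ` of their logarithms, there is `C > 0` such that for every `B ≥ 2` and all `β₀, …, βₙ` each a root of
a non-zero integer polynomial of degree `≤ d` and height `≤ B`: `Λ = β₀ + Σ βᵢ lᵢ = 0` or `|Λ| > B^{−C}`.
NOT S IN COSTUME: this is a proved theorem about linear forms in logarithms of ALGEBRAIC numbers — strictly below
Schanuel (it says nothing about algebraic independence) and consumed here only BY NAME, as the binder of
`piEllMeasure_of_baker` / `not_hasHLPairInSpan_zB_of_baker`.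
TODO (port): replace the copy by `import Literature.NumberTheory.Transcendental.BakerLinearFormsQuantitative(Proofs)` +
`baker1975_thm_3_1_holds` when the Baker chain builds on the farm (rc 75 `unbuilt` throughout generation 18).
[cite: BakerTNT1975, Ch. 3 Thm 3.1 (PDF p. 27)] -/
def Baker1975Thm31 : Prop :=
  ∀ (n d A : ℕ) (α l : Fin n → ℂ),
    (∀ i, α i ≠ 0) → (∀ i, Complex.exp (l i) = α i) →
    (∀ i, ∃ P : ℤ[X], P ≠ 0 ∧ P.natDegree ≤ d ∧ (∀ j, |P.coeff j| ≤ (A : ℤ)) ∧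
      Polynomial.aeval (α i) P = 0) →
    ∃ C : ℝ, 0 < C ∧ ∀ B : ℕ, 2 ≤ B → ∀ β : Fin (n + 1) → ℂ,
      (∀ j, ∃ Q : ℤ[X], Q ≠ 0 ∧ Q.natDegree ≤ d ∧ (∀ k, |Q.coeff k| ≤ (B : ℤ)) ∧
        Polynomial.aeval (β j) Q = 0) →
      (β 0 + ∑ i : Fin n, β i.succ * l i = 0 ∨
        (B : ℝ) ^ (-C) < ‖β 0 + ∑ i : Fin n, β i.succ * l i‖)

/-- **`PiEllMeasure` from Baker 1975 Thm 3.1** (the tree's record `baker1975_thm_3_1`, `n = 2`, `d = 2`, `A = 6`,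
`α = (−1, α₀)`, `l = (iπ, iℓ₀)`, `β = (0, U, V)`, `B = max(2, |U|, |V|)`; `Λ = i(Uπ + Vℓ₀) ≠ 0` by the elementary
`lattice_ne_zero`). -/
theorem piEllMeasure_of_baker (hB : Baker1975Thm31) : PiEllMeasure := by
  obtain ⟨C, hC, hmain⟩ := hB 2 2 6 ![-1, (3 + 4 * I) / 5] ![(Real.pi : ℂ) * I, (ell : ℂ) * I]
    (fun i => by
      fin_cases i
      · simp
      · simp [Complex.ext_iff])
    (fun i => by
      fin_cases i
      · simp
      · simpa using cexp_ell)
    (fun i => by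
      fin_cases i
      · simpa using wit_neg_one
      · simpa using wit_alpha0)
  refine ⟨⌈C⌉₊, fun U V hV => ?_⟩
  set Bn : ℕ := max 2 (max U.natAbs V.natAbs) with hBn
  have hB2 : 2 ≤ Bn := le_max_left _ _
  have hUB : U.natAbs ≤ Bn := le_trans (le_max_left _ _) (le_max_right _ _)
  have hVB : V.natAbs ≤ Bn := le_trans (le_max_right _ _) (le_max_right _ _)
  let βz : Fin 3 → ℤ := ![0, U, V]
  have hβB : ∀ j, (βz j).natAbs ≤ Bn := by
    intro j
    fin_cases j
    · simp [βz]
    · simpa [βz] using hUB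
    · simpa [βz] using hVB
  have hres := hmain Bn hB2 (fun j => (βz j : ℂ)) (fun j => wit_int (βz j) hB2 (hβB j))
  have hΛ : ((βz 0 : ℤ) : ℂ) + ∑ i : Fin 2, ((βz i.succ : ℤ) : ℂ) * ![(Real.pi : ℂ) * I, (ell : ℂ) * I] i =
      ((((U : ℝ) * Real.pi + (V : ℝ) * ell : ℝ)) : ℂ) * I := by
    simp only [Fin.sum_univ_two, βz]
    simp
    ring
  rw [hΛ] at hres
  rcases hres with h0 | hlt
  · exfalso
    rcases mul_eq_zero.mp h0 with h1 | h1
    · exact lattice_ne_zero U hV (by exact_mod_cast h1)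
    · exact I_ne_zero h1
  · rw [norm_mul, Complex.norm_I, mul_one, Complex.norm_real, Real.norm_eq_abs] at hlt
    have hBpos : (0 : ℝ) < Bn := by positivity
    have hB1 : (1 : ℝ) ≤ Bn := by exact_mod_cast (show 1 ≤ Bn by omega)
    have hBle : (Bn : ℝ) ≤ 2 + |(U : ℝ)| + |(V : ℝ)| := by
      have h1 : Bn ≤ 2 + U.natAbs + V.natAbs := by omega
      have h2 : (Bn : ℝ) ≤ ((2 + U.natAbs + V.natAbs : ℕ) : ℝ) := by exact_mod_cast h1
      push_cast at h2
      rw [Nat.cast_natAbs, Nat.cast_natAbs, Int.cast_abs, Int.cast_abs] at h2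
      exact h2
    calc 1 / (2 + |(U : ℝ)| + |(V : ℝ)|) ^ ⌈C⌉₊ ≤ 1 / (Bn : ℝ) ^ ⌈C⌉₊ :=
          one_div_le_one_div_of_le (pow_pos hBpos _) (pow_le_pow_left₀ hBpos.le hBle _)
      _ = (Bn : ℝ) ^ (-(⌈C⌉₊ : ℝ)) := by
          rw [Real.rpow_neg hBpos.le, Real.rpow_natCast, one_div]
      _ ≤ (Bn : ℝ) ^ (-C) := Real.rpow_le_rpow_of_exponent_le hB1 (neg_le_neg (Nat.le_ceil C))
      _ ≤ |(U : ℝ) * Real.pi + (V : ℝ) * ell| := hlt.le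

/-- The measure with `(U, V) ≠ 0` (for `V = 0` the form is `Uπ`, `|Uπ| ≥ π > 1`). -/
theorem piEllMeasure_apply {κ : ℕ}
    (hκ : ∀ U V : ℤ, V ≠ 0 → 1 / (2 + |(U : ℝ)| + |(V : ℝ)|) ^ κ ≤ |(U : ℝ) * Real.pi + (V : ℝ) * ell|)
    (U V : ℤ) (hUV : U ≠ 0 ∨ V ≠ 0) :
    1 / (2 + |(U : ℝ)| + |(V : ℝ)|) ^ κ ≤ |(U : ℝ) * Real.pi + (V : ℝ) * ell| := by
  rcases eq_or_ne V 0 with hV0 | hV0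
  · have hU0 : U ≠ 0 := hUV.resolve_right (not_not.mpr hV0)
    subst hV0
    have h1 : (1 : ℝ) ≤ |(U : ℝ)| := by rw [← Int.cast_abs]; exact_mod_cast Int.one_le_abs hU0
    have h2 : 1 / (2 + |(U : ℝ)| + |((0 : ℤ) : ℝ)|) ^ κ ≤ 1 := by
      rw [div_le_one (by positivity)]
      exact one_le_pow₀ (by simp; linarith [abs_nonneg (U : ℝ)])
    calc 1 / (2 + |(U : ℝ)| + |((0 : ℤ) : ℝ)|) ^ κ ≤ 1 := h2
      _ ≤ |(U : ℝ)| * Real.pi := by nlinarith [Real.pi_gt_three]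
      _ = |(U : ℝ) * Real.pi + ((0 : ℤ) : ℝ) * ell| := by
          rw [Int.cast_zero, zero_mul, add_zero, abs_mul, abs_of_pos Real.pi_pos]
  · exact hκ U V hV0

/-! ### §T.2  The good level of the tower `a₀ = 1`, `a_{k+1} = 2^{(k+1)a_k}` -/

/-- `n · D ≤ n ^ D` for `n ≥ 2`, `D ≥ 1`. -/
private theorem mul_le_pow_of_two_le {n D : ℕ} (hn : 2 ≤ n) (hD : 1 ≤ D) : n * D ≤ n ^ D := by
  obtain ⟨D', rfl⟩ : ∃ D', D = D' + 1 := ⟨D - 1, by omega⟩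
  have h1 : D' + 1 ≤ 2 ^ D' := Nat.lt_two_pow_self
  calc n * (D' + 1) ≤ n * 2 ^ D' := Nat.mul_le_mul_left _ h1
    _ ≤ n * n ^ D' := Nat.mul_le_mul_left _ (Nat.pow_le_pow_left hn _)
    _ = n ^ (D' + 1) := by ring

/-- `a² ≤ 2^{a−1}` for `a ≥ 7`. -/
private theorem sq_le_two_pow_pred {a : ℕ} (ha : 7 ≤ a) : a * a ≤ 2 ^ (a - 1) := by
  induction a, ha using Nat.le_induction with
  | base => norm_num
  | succ a ha ih =>
      have e : a + 1 - 1 = (a - 1) + 1 := by omega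
      rw [e, pow_succ]
      have h7 : 7 * 7 ≤ a * a := Nat.mul_le_mul ha ha
      nlinarith [ih, h7, ha]

/-- **The good level.**  For `N ≥ 1` and `κ`, with `X = 2(κ+2)(N+κ+16)`, some level `K` has `a_K < X` and
`(8 · 2^{a_K} · N)^{κ+2} ≤ 2^{a_{K+1}}` (take the least `K` with `X ≤ a_{K+1}`). -/
theorem exists_goodLevel (κ N : ℕ) :
    ∃ K : ℕ, hexp K < 2 * (κ + 2) * (N + κ + 16) ∧
      (8 * 2 ^ hexp K * N) ^ (κ + 2) ≤ 2 ^ hexp (K + 1) := by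
  classical
  set X := 2 * (κ + 2) * (N + κ + 16) with hX
  have hex : ∃ k, X ≤ hexp (k + 1) := ⟨X, by have := succ_le_hexp (X + 1); omega⟩
  obtain ⟨K, hK1, hKmin⟩ : ∃ K, X ≤ hexp (K + 1) ∧ ∀ K' < K, ¬ (X ≤ hexp (K' + 1)) :=
    ⟨Nat.find hex, Nat.find_spec hex, fun K' hK' => Nat.find_min hex hK'⟩
  have hX8 : 4 * (N + 16) ≤ X := by
    rw [hX]
    calc 4 * (N + 16) = (2 * 2) * (N + 16) := by ring
      _ ≤ (2 * (κ + 2)) * (N + κ + 16) := Nat.mul_le_mul (by omega) (by omega)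
  have hK2 : hexp K < X := by
    rcases Nat.eq_zero_or_pos K with h0 | hpos
    · rw [h0, hexp_zero]; omega
    · obtain ⟨K', hK'⟩ : ∃ K', K = K' + 1 := ⟨K - 1, by omega⟩
      have hmin := hKmin K' (by omega)
      rw [hK']; omega
  refine ⟨K, hK2, ?_⟩
  set a := hexp K with ha
  have hNpow : N ≤ 2 ^ N := Nat.lt_two_pow_self.le
  have h1 : 8 * 2 ^ a * N ≤ 2 ^ (3 + a + N) := by
    rw [pow_add, pow_add]
    calc 8 * 2 ^ a * N ≤ 8 * 2 ^ a * 2 ^ N := Nat.mul_le_mul_left _ hNpow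
      _ = 2 ^ 3 * 2 ^ a * 2 ^ N := by norm_num
  have h2 : (8 * 2 ^ a * N) ^ (κ + 2) ≤ 2 ^ ((3 + a + N) * (κ + 2)) := by
    rw [pow_mul]; exact Nat.pow_le_pow_left h1 _
  refine h2.trans (Nat.pow_le_pow_right (by norm_num) ?_)
  have hXle : 2 * ((3 + N) * (κ + 2)) ≤ X := by
    rw [hX, Nat.mul_assoc]
    apply Nat.mul_le_mul_left
    rw [Nat.mul_comm (3 + N)]
    exact Nat.mul_le_mul_left _ (by omega)
  have h2a : 2 ^ a ≤ hexp (K + 1) := by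
    rw [hexp_succ]
    exact Nat.pow_le_pow_right (by norm_num) (Nat.le_mul_of_pos_left _ (by omega))
  rcases Nat.lt_or_ge a (κ + 14) with hlt | hge
  · calc (3 + a + N) * (κ + 2) ≤ (N + κ + 16) * (κ + 2) := Nat.mul_le_mul_right _ (by omega)
      _ ≤ X := by
          rw [hX, Nat.mul_comm (N + κ + 16), Nat.mul_assoc]
          exact Nat.le_mul_of_pos_left _ (by norm_num)
      _ ≤ hexp (K + 1) := hK1
  · have h3 : a * (κ + 2) ≤ 2 ^ (a - 1) :=
      (Nat.mul_le_mul_left _ (by omega)).trans (sq_le_two_pow_pred (by omega))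
    have h4 : 2 * 2 ^ (a - 1) = 2 ^ a := by
      rw [← pow_succ']; congr 1; omega
    have h5 : 2 * ((3 + a + N) * (κ + 2)) ≤ 2 * hexp (K + 1) := by
      calc 2 * ((3 + a + N) * (κ + 2)) = 2 * ((3 + N) * (κ + 2)) + 2 * (a * (κ + 2)) := by ring
        _ ≤ X + 2 * 2 ^ (a - 1) := Nat.add_le_add hXle (Nat.mul_le_mul_left _ h3)
        _ = X + 2 ^ a := by rw [h4]
        _ ≤ hexp (K + 1) + hexp (K + 1) := Nat.add_le_add hK1 h2a
        _ = 2 * hexp (K + 1) := by ring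
    omega

/-- The final exponent comparison: `(3 + X + N)(κ+2) ≤ (1+N)^{m₀}`, `m₀ = 4(κ+2)²(κ+16)`. -/
theorem level_exponent_le (κ N : ℕ) (hN : 1 ≤ N) :
    (3 + 2 * (κ + 2) * (N + κ + 16) + N) * (κ + 2) ≤ (1 + N) ^ (4 * (κ + 2) ^ 2 * (κ + 16)) := by
  have hX8 : 4 * (N + 16) ≤ 2 * (κ + 2) * (N + κ + 16) :=
    calc 4 * (N + 16) = (2 * 2) * (N + 16) := by ring
      _ ≤ (2 * (κ + 2)) * (N + κ + 16) := Nat.mul_le_mul (by omega) (by omega)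
  have h1 : 3 + 2 * (κ + 2) * (N + κ + 16) + N ≤ 2 * (2 * (κ + 2) * (N + κ + 16)) := by omega
  have h2 : N + κ + 16 ≤ (κ + 16) * (1 + N) := by nlinarith
  have h3 : (3 + 2 * (κ + 2) * (N + κ + 16) + N) * (κ + 2) ≤ (1 + N) * (4 * (κ + 2) ^ 2 * (κ + 16)) :=
    calc (3 + 2 * (κ + 2) * (N + κ + 16) + N) * (κ + 2)
        ≤ (2 * (2 * (κ + 2) * (N + κ + 16))) * (κ + 2) := Nat.mul_le_mul_right _ h1
      _ = (4 * (κ + 2) ^ 2) * (N + κ + 16) := by ring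
      _ ≤ (4 * (κ + 2) ^ 2) * ((κ + 16) * (1 + N)) := Nat.mul_le_mul_left _ h2
      _ = (1 + N) * (4 * (κ + 2) ^ 2 * (κ + 16)) := by ring
  refine h3.trans (mul_le_pow_of_two_le (by omega) ?_)
  have : 1 ≤ (κ + 2) ^ 2 := Nat.one_le_pow _ _ (by omega)
  nlinarith

/-- `2^A ≤ exp A`. -/
private theorem two_pow_le_exp_nat (A : ℕ) : (2 : ℝ) ^ A ≤ Real.exp A := by
  calc (2 : ℝ) ^ A ≤ Real.exp 1 ^ A :=
        pow_le_pow_left₀ (by norm_num) (by have := Real.add_one_le_exp (1 : ℝ); linarith) A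
    _ = Real.exp A := by rw [← Real.exp_nat_mul, mul_one]

end MemberPkg

end Bilog
end LatCell
end HyperCell
end Summit.Schanuel.Schanuel.Theorems.RootDecomp1KHyper
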